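import Summits.BirchSwinnertonDyer.BirchSwinnertonDyer.Theorems.ManinLocalTwoThreeShimuraIndexKatz
import Literature.NumberTheory.EllipticCurves.SupersingularDensitySerreFrobeniusProofs
import Literature.NumberTheory.EllipticCurves.ShimuraSubgroupHeckeCongruence
import Literature.NumberTheory.EllipticCurves.NewformPeterssonSizeSymmSquareProofs
import HarnessLib

/-!
# The Shimura index is read at the prime `2`: `[Λ₀(f) : Λ₁(f)]` is supported on `{2, 3, 5}` — UNCONDITIONALLY (no Mazur),
# and its `p`-part is decided by `a₂` alone

Summit `BirchSwinnertonDyer`, route `ManinLocalTwoThree` (cell bsd-f2-manin), crux C2 `ManinOddAtFour`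
(stmt-BirchSwinnertonDyer-22967; bears equally on C3 stmt-BirchSwinnertonDyer-22968).  Planner seat bsd-f2-manin-es
(Euler-system / explicit-reciprocity lens), gen 42; MEMO-es §64, rows E-es-209/210.  Sequel to p1's
`ManinLocalTwoThreeShimuraIndexKatz.lean` §3, which proved «`ℓ ≥ 11 ⟹ ℓ ∤ [Λ₀ : Λ₁]`» GRANTED Mazur's torsion theorem,
leaving the support of the Shimura-cover kernel `Λ₀(f)/Λ₁(f)` inside `{2, 3, 5, 7}`.

THE MOVE.  Read the Eisenstein property of the Shimura quotient (Ribet; Ling–Oesterlé Thm. 6: `T_ℓ = ℓ + 1` on `Σ(N)` for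
`ℓ ∤ N`, `T_p = p` for `p ∣ N`; tree `sub_sub_mul_mem_periodLatticeGamma1_of_isNewform0`, `heckeEigenPeriodCongruence_holds`)
at the SMALLEST prime `ℓ = 2`, where Hasse (`a₂² ≤ 8`, tree `frobeniusTrace_sq_le_four_mul`) resp. Atkin–Lehner
(`a₂ ∈ {0, ±1}` for `2 ∣ N`, tree `IsNewform0.cuspCoeff_eq_zero_of_sq_dvd` / `cuspCoeff_sq_eq_one_of_dvd_of_not_sq_dvd`) make the
Eisenstein number `ε₂ := a₂ − 3` (odd `N`) resp. `a₂ − 2` (even `N`) a NON-ZERO integer of absolute value `≤ 5` resp. `≤ 3`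
that kills `Λ₀(f)/Λ₁(f)`.  Hence, for the newform `f` of a globally minimal elliptic `W/ℚ` (`IsNewformOf W f`, any level):

* `shimuraIndexPrimeTo_of_seven_le` — **every prime `p ≥ 7` is prime to `[Λ₀(f) : Λ₁(f)]`**, UNCONDITIONALLY (Mazur removed,
  `p = 7` closed): the Shimura-cover kernel is supported on `{2, 3, 5}`;
* `shimuraIndexPrimeTo_of_five_le_of_two_dvd` — at EVEN level every `p ≥ 5` is prime to the index (support `⊆ {2, 3}`);
* `shimuraIndexPrimeTo_two_of_two_dvd_of_not_four_dvd` — at `2 ∥ N` the index is ODD;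
* `cuspCoeff_two_eq_neg_one_of_not_shimuraIndexPrimeTo_three` — at even level `3 ∣ index ⟹ 2 ∥ N ∧ a₂(f) = −1`;
* `frobeniusTrace_two_eq_of_not_shimuraIndexPrimeTo_five / _three / _two` — at ODD level: `5 ∣ index ⟹ a₂(W) = −2`,
  `3 ∣ index ⟹ a₂(W) = 0`, `2 ∣ index ⟹ a₂(W)` odd (`X₀(11)`: `a₂ = −2`, index `5`);
* `exists_intCast_mul_mem_periodLatticeGamma1_le_five` — the EXPONENT form: some integer `1 ≤ k ≤ 5` has `k·Λ₀(f) ⊆ Λ₁(f)`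
  (`k = 3 − a₂(W)` at odd level, `k = 2 − a₂(f) ∈ {1, 2, 3}` at even level);
* `two_mul_mem_or_three_mul_mem` (§4) — the Derickx–Orlić shape `2Λ₀ ⊆ Λ₁ ∨ 3Λ₀ ⊆ Λ₁` (E-es-193) holds UNCONDITIONALLY at
  even level and at odd level with `a₂(W) ≥ 0`, at every `N`; the residue `2 ∤ N ∧ a₂(W) ∈ {−1, −2}` is rows E-es-211/212
  (HOME/es/g42/Rows-es-g42.lean: E-es-193m ⟺ E-es-211 ∧ E-es-212, proved modulo `oddLevelEisensteinAtTwo`,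
  `evenLevelEisensteinAtTwo` of §4).

In print the order of `E₀ ∩ Σ(N)` (`= [Λ₀ : Λ₁]` for the optimal quotient) is bounded by `16` via Mazur (Derickx–Orlić 2025,
Rmk. 4.8) and conjectured to lie in `{1, 2, 3, 4, 5}` (Stein–Watkins 2002, quoted in Byeon–Kim 2014 p. 2); the `ℓ = 2` reading is
a two-line corollary of Ling–Oesterlé's Theorem 6 with Hasse, not claimed beyond print — what is new is the TREE currency:
the support `{2, 3, 5}` and the `a₂`-laws with NO torsion input.

LANDING NOTE (LEAD prover p1 gen 23, T-es-79): es g42's `HOME/es/g42/ShimuraIndexAtTwo-es-g42.lean` (sha16 d13c2d598acd30d0) VERBATIM, authored by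
planner seat es g42; §4 (the Derickx–Orlić shape and the two Eisenstein inputs `oddLevelEisensteinAtTwo` / `evenLevelEisensteinAtTwo`) is split off
into the sibling `ManinLocalTwoThreeShimuraIndexAtTwoExponent.lean` for the 400-line rule; nothing else changed.

HONEST FRAMING: unconditional tree theorems (standard axioms); no definitions, no named facts, no sorry.  C2, C3, Manin's
conjecture and BSD are NOT proved by this file.

References: S. Ling, J. Oesterlé, Astérisque 196–197 (1991), Thm. 6 [LingOesterle1991]; K. Ribet, Sém. Th. Nombres Bordeaux
1987–88, exp. 6 [Ribet1988Shimura]; J. H. Silverman, AEC, Thm. V.1.1 [SilvermanAEC2009]; A. O. L. Atkin, J. Lehner, Math. Ann.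
185 (1970), Thm. 3 [AtkinLehner1970]; W. Stein, M. Watkins, ANTS V (2002) [SteinWatkins2002]; D. Byeon, T. Kim, Acta Arith. 165
(2014), p. 2 [ByeonKim2014]; M. Derickx, P. Orlić, arXiv:2504.15937, Rmk. 4.8 [DerickxOrlic2025].
-/

set_option autoImplicit false
-- lint-debt: the directory name repeats the summit name (sibling precedent `ManinLocalTwoThreeShimuraIndexKatz.lean`)
set_option linter.dupNamespace false

noncomputable section

open scoped MatrixGroups ModularForm

open CongruenceSubgroup Complex WeierstrassCurve Literature.NumberTheory.EllipticCurves
  Literature.NumberTheory.EllipticCurves.ModularForms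
open Summit.BirchSwinnertonDyer.Rank1Residual.ManinAdditive.KatoCurve

namespace Summit.BirchSwinnertonDyer.BirchSwinnertonDyer.Theorems.ManinLocalTwoThree.ShimuraIndexAtTwo

/-! ### §0. An integer lemma -/

/-- A non-zero integer strictly between `−p` and `p` is not divisible by `p`. [folklore] -/
theorem not_natCast_dvd_of_abs_lt {p : ℕ} {m : ℤ} (hm : m ≠ 0) (h₁ : -(p : ℤ) < m) (h₂ : m < p) :
    ¬ (p : ℤ) ∣ m := by
  rintro ⟨k, rfl⟩
  have hp0 : (0 : ℤ) ≤ p := by exact_mod_cast Nat.zero_le p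
  rcases lt_trichotomy k 0 with hk | hk | hk
  · have : k ≤ -1 := by omega
    nlinarith
  · exact hm (by rw [hk, mul_zero])
  · have : 1 ≤ k := by omega
    nlinarith

-- (LANDING NOTE: es's convenience restatement `mem_of_intCast_mul_mem` of the tree lemma `mem_of_intCast_mul_mem_of_prime_mul_mem`
-- is dropped (dedup rule); the tree lemma is used by name below.)

/-! ### §1. Even level: `T₂ = U₂`, `a₂(f) ∈ {0, ±1}`, `(a₂ − 2)Λ₀ ⊆ Λ₁` -/

section Even

variable {N : ℕ} [NeZero N]

/-- At even level the `U₂`-eigenvalue of a newform is `0` (if `4 ∣ N`) or `±1` (if `2 ∥ N`): `∃ e ∈ {0, 1, −1}` with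
`a₂(f) = e`, and `e = 0 ↔ 4 ∣ N`. [cite: AtkinLehner1970, Thm. 3] -/
theorem exists_cuspCoeff_two_eq_of_two_dvd {f : CuspForm (Gamma0 N) 2} (hf : IsNewform0 f) (hN : 2 ∣ N) :
    ∃ e : ℤ, cuspCoeff f 2 = (e : ℂ) ∧ ((2 ^ 2 ∣ N ∧ e = 0) ∨ (¬ 2 ^ 2 ∣ N ∧ (e = 1 ∨ e = -1))) := by
  by_cases h4 : 2 ^ 2 ∣ N
  · exact ⟨0, by rw [hf.cuspCoeff_eq_zero_of_sq_dvd Nat.prime_two h4]; simp, Or.inl ⟨h4, rfl⟩⟩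
  · have hsq : cuspCoeff f 2 ^ 2 = 1 := hf.cuspCoeff_sq_eq_one_of_dvd_of_not_sq_dvd Nat.prime_two hN h4
    rw [sq, mul_self_eq_one_iff] at hsq
    rcases hsq with h | h
    · exact ⟨1, by rw [h]; simp, Or.inr ⟨h4, Or.inl rfl⟩⟩
    · exact ⟨-1, by rw [h]; simp, Or.inr ⟨h4, Or.inr rfl⟩⟩

/-- THEOREM W at `p = 2`: `(a₂(f) − 2) Λ₀(f) ⊆ Λ₁(f)` for a newform of even level. [cite: LingOesterle1991, Thm. 6 («T_p = p on Σ(N), p ∣ N»)] -/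
theorem sub_two_mul_mem_periodLatticeGamma1_of_two_dvd {f : CuspForm (Gamma0 N) 2} (hf : IsNewform0 f) (hN : 2 ∣ N)
    {z : ℂ} (hz : z ∈ periodLattice f) : (cuspCoeff f 2 - 2) * z ∈ periodLatticeGamma1 f := by
  have h := heckeEigenPeriodCongruence_holds N 2 f (cuspCoeff f 2) Nat.prime_two hN
    (hf.heckeT_eq_coeff_smul Nat.prime_two) z hz
  exact_mod_cast h

/-- **Even level: every prime `p ≥ 5` is prime to `[Λ₀(f) : Λ₁(f)]`** (`a₂ − 2 ∈ {−1, −2, −3}` kills the quotient).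
Unconditional. [cite: LingOesterle1991, Thm. 6] [cite: AtkinLehner1970, Thm. 3] -/
theorem shimuraIndexPrimeTo_of_five_le_of_two_dvd {f : CuspForm (Gamma0 N) 2} (hf : IsNewform0 f) (hN : 2 ∣ N)
    {p : ℕ} (hp : p.Prime) (h5 : 5 ≤ p) : ShimuraIndexPrimeTo p f := by
  intro x hx hpx
  obtain ⟨e, he, hcase⟩ := exists_cuspCoeff_two_eq_of_two_dvd hf hN
  have hE : ((e - 2 : ℤ) : ℂ) * x ∈ periodLatticeGamma1 f := by
    have h := sub_two_mul_mem_periodLatticeGamma1_of_two_dvd hf hN hx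
    rw [he] at h
    exact_mod_cast h
  refine mem_of_intCast_mul_mem_of_prime_mul_mem hp (not_natCast_dvd_of_abs_lt ?_ ?_ ?_) hE hpx
  · rcases hcase with ⟨-, rfl⟩ | ⟨-, rfl | rfl⟩ <;> norm_num
  · have : (5 : ℤ) ≤ p := by exact_mod_cast h5
    rcases hcase with ⟨-, rfl⟩ | ⟨-, rfl | rfl⟩ <;> omega
  · have : (5 : ℤ) ≤ p := by exact_mod_cast h5
    rcases hcase with ⟨-, rfl⟩ | ⟨-, rfl | rfl⟩ <;> omega

/-- **`2 ∥ N` ⟹ the Shimura index is ODD** (`a₂ = ±1`, `a₂ − 2 ∈ {−1, −3}` is odd). Unconditional.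
[cite: LingOesterle1991, Thm. 6] [cite: AtkinLehner1970, Thm. 3] -/
theorem shimuraIndexPrimeTo_two_of_two_dvd_of_not_four_dvd {f : CuspForm (Gamma0 N) 2} (hf : IsNewform0 f)
    (hN : 2 ∣ N) (h4 : ¬ 2 ^ 2 ∣ N) : ShimuraIndexPrimeTo 2 f := by
  intro x hx hpx
  obtain ⟨e, he, hcase⟩ := exists_cuspCoeff_two_eq_of_two_dvd hf hN
  have hE : ((e - 2 : ℤ) : ℂ) * x ∈ periodLatticeGamma1 f := by
    have h := sub_two_mul_mem_periodLatticeGamma1_of_two_dvd hf hN hx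
    rw [he] at h
    exact_mod_cast h
  refine mem_of_intCast_mul_mem_of_prime_mul_mem Nat.prime_two ?_ hE hpx
  rcases hcase with ⟨h4', -⟩ | ⟨-, rfl | rfl⟩
  · exact absurd h4' h4
  · norm_num
  · norm_num

/-- **Even level: `3 ∣ [Λ₀ : Λ₁]` forces `2 ∥ N` and `a₂(f) = −1`** (non-split multiplicative reduction at `2` for the
optimal quotient). Unconditional. [cite: LingOesterle1991, Thm. 6] [cite: AtkinLehner1970, Thm. 3] -/
theorem cuspCoeff_two_eq_neg_one_of_not_shimuraIndexPrimeTo_three {f : CuspForm (Gamma0 N) 2} (hf : IsNewform0 f)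
    (hN : 2 ∣ N) (hS : ¬ ShimuraIndexPrimeTo 3 f) : ¬ 2 ^ 2 ∣ N ∧ cuspCoeff f 2 = -1 := by
  obtain ⟨e, he, hcase⟩ := exists_cuspCoeff_two_eq_of_two_dvd hf hN
  have key : (3 : ℤ) ∣ e - 2 := by
    by_contra hnd
    apply hS
    intro x hx hpx
    have hE : ((e - 2 : ℤ) : ℂ) * x ∈ periodLatticeGamma1 f := by
      have h := sub_two_mul_mem_periodLatticeGamma1_of_two_dvd hf hN hx
      rw [he] at h
      exact_mod_cast h
    exact mem_of_intCast_mul_mem_of_prime_mul_mem Nat.prime_three (by exact_mod_cast hnd) hE hpx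
  rcases hcase with ⟨-, rfl⟩ | ⟨h4, rfl | rfl⟩
  · omega
  · omega
  · exact ⟨h4, by rw [he]; simp⟩

end Even

/-! ### §2. Odd level: `2 ∤ N`, good reduction at `2`, `(a₂(W) − 3)Λ₀ ⊆ Λ₁`, `|a₂(W)| ≤ 2` -/

section Odd

variable (W : WeierstrassCurve ℚ) [W.IsElliptic] [W.IsGloballyMinimal] {N : ℕ} [NeZero N]

omit [W.IsGloballyMinimal] in
/-- `2 ∤ N` ⟹ good reduction at `2` for the curve of the newform (`N = N_W` prime by prime, tree
`IsNewformOf.dvd_level_iff_dvd_conductorNorm`). [cite: Carayol1986, Thm. (A)] -/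
theorem hasGoodReductionAtPrime_two_of_not_two_dvd {f : CuspForm (Gamma0 N) 2} (hf : IsNewformOf W f) (hN : ¬ 2 ∣ N) :
    W.HasGoodReductionAtPrime 2 := by
  by_contra hbad
  exact hN ((hf.dvd_level_iff_dvd_conductorNorm Nat.prime_two).mpr
    ((W.dvd_conductorNorm_iff_not_hasGoodReductionAtPrime 2).mpr hbad))

/-- Hasse at `2`: `|a₂(W)| ≤ 2` (`a₂² ≤ 8 < 9`). [cite: SilvermanAEC2009, Thm. V.1.1] -/
theorem abs_frobeniusTrace_two_le_two (hgood : W.HasGoodReductionAtPrime 2) : |W.frobeniusTrace 2| ≤ 2 := by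
  have h : W.frobeniusTrace 2 ^ 2 ≤ 4 * 2 := W.frobeniusTrace_sq_le_four_mul 2 hgood
  rw [abs_le]
  constructor <;> nlinarith [h, sq_nonneg (W.frobeniusTrace 2 + 3), sq_nonneg (W.frobeniusTrace 2 - 3)]

/-- THE EISENSTEIN NUMBER AT `2`: at odd level `(a₂(W) − 3)·Λ₀(f) ⊆ Λ₁(f)` (tree `sub_sub_mul_mem_periodLatticeGamma1_of_isNewform0`
at `ℓ = 2`, `a₂(f) = a₂(W)` by `LFunction_apply_prime_eq_frobeniusTrace`). [cite: LingOesterle1991, Thm. 6 («T_ℓ = ℓ + 1 on Σ(N), ℓ ∤ N»)] [cite: Ribet1988Shimura, Thm. 1] -/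
theorem frobeniusTrace_two_sub_three_mul_mem {f : CuspForm (Gamma0 N) 2} (hf : IsNewformOf W f) (hN : ¬ 2 ∣ N)
    {z : ℂ} (hz : z ∈ periodLattice f) : ((W.frobeniusTrace 2 - 3 : ℤ) : ℂ) * z ∈ periodLatticeGamma1 f := by
  have hgood := hasGoodReductionAtPrime_two_of_not_two_dvd W hf hN
  have hE := sub_sub_mul_mem_periodLatticeGamma1_of_isNewform0 f hf.1 Nat.prime_two hN hz
  rw [hf.2 2, LFunction_apply_prime_eq_frobeniusTrace W 2 hgood] at hE
  convert hE using 2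
  push_cast
  ring

/-- **Odd level: `p ∣ [Λ₀ : Λ₁]` forces `p ∣ a₂(W) − 3`.** [cite: LingOesterle1991, Thm. 6] [cite: Ribet1988Shimura, Thm. 1] -/
theorem dvd_frobeniusTrace_two_sub_three_of_not_shimuraIndexPrimeTo {f : CuspForm (Gamma0 N) 2} (hf : IsNewformOf W f)
    (hN : ¬ 2 ∣ N) {p : ℕ} (hp : p.Prime) (hS : ¬ ShimuraIndexPrimeTo p f) : (p : ℤ) ∣ W.frobeniusTrace 2 - 3 := by
  by_contra hnd
  exact hS fun x hx hpx ↦ mem_of_intCast_mul_mem_of_prime_mul_mem hp hnd (frobeniusTrace_two_sub_three_mul_mem W hf hN hx) hpx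

/-- **Odd level: `5 ∣ [Λ₀ : Λ₁]` forces `a₂(W) = −2`** (`#W̃(𝔽₂) = 5`; e.g. `X₀(11)`). Unconditional.
[cite: LingOesterle1991, Thm. 6] [cite: SilvermanAEC2009, Thm. V.1.1] -/
theorem frobeniusTrace_two_eq_of_not_shimuraIndexPrimeTo_five {f : CuspForm (Gamma0 N) 2} (hf : IsNewformOf W f)
    (hN : ¬ 2 ∣ N) (hS : ¬ ShimuraIndexPrimeTo 5 f) : W.frobeniusTrace 2 = -2 := by
  have hd := dvd_frobeniusTrace_two_sub_three_of_not_shimuraIndexPrimeTo W hf hN Nat.prime_five hS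
  have ha := abs_le.mp (abs_frobeniusTrace_two_le_two W (hasGoodReductionAtPrime_two_of_not_two_dvd W hf hN))
  omega

/-- **Odd level: `3 ∣ [Λ₀ : Λ₁]` forces `a₂(W) = 0`** (`W̃/𝔽₂` supersingular). Unconditional.
[cite: LingOesterle1991, Thm. 6] [cite: SilvermanAEC2009, Thm. V.1.1] -/
theorem frobeniusTrace_two_eq_of_not_shimuraIndexPrimeTo_three {f : CuspForm (Gamma0 N) 2} (hf : IsNewformOf W f)
    (hN : ¬ 2 ∣ N) (hS : ¬ ShimuraIndexPrimeTo 3 f) : W.frobeniusTrace 2 = 0 := by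
  have hd := dvd_frobeniusTrace_two_sub_three_of_not_shimuraIndexPrimeTo W hf hN Nat.prime_three hS
  have ha := abs_le.mp (abs_frobeniusTrace_two_le_two W (hasGoodReductionAtPrime_two_of_not_two_dvd W hf hN))
  omega

/-- **Odd level: `2 ∣ [Λ₀ : Λ₁]` forces `a₂(W)` ODD** (`= ±1`; `W̃(𝔽₂)` has no `𝔽₂`-rational `2`-torsion). Unconditional.
[cite: LingOesterle1991, Thm. 6] [cite: SilvermanAEC2009, Thm. V.1.1] -/
theorem frobeniusTrace_two_eq_of_not_shimuraIndexPrimeTo_two {f : CuspForm (Gamma0 N) 2} (hf : IsNewformOf W f)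
    (hN : ¬ 2 ∣ N) (hS : ¬ ShimuraIndexPrimeTo 2 f) : W.frobeniusTrace 2 = 1 ∨ W.frobeniusTrace 2 = -1 := by
  have hd := dvd_frobeniusTrace_two_sub_three_of_not_shimuraIndexPrimeTo W hf hN Nat.prime_two hS
  have ha := abs_le.mp (abs_frobeniusTrace_two_le_two W (hasGoodReductionAtPrime_two_of_not_two_dvd W hf hN))
  omega

/-- **Odd level: every prime `p ≥ 7` is prime to `[Λ₀ : Λ₁]`** (`a₂ − 3 ∈ [−5, −1]`). Unconditional.
[cite: LingOesterle1991, Thm. 6] [cite: SilvermanAEC2009, Thm. V.1.1] -/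
theorem shimuraIndexPrimeTo_of_seven_le_of_not_two_dvd {f : CuspForm (Gamma0 N) 2} (hf : IsNewformOf W f)
    (hN : ¬ 2 ∣ N) {p : ℕ} (hp : p.Prime) (h7 : 7 ≤ p) : ShimuraIndexPrimeTo p f := by
  by_contra hS
  have hd := dvd_frobeniusTrace_two_sub_three_of_not_shimuraIndexPrimeTo W hf hN hp hS
  have ha := abs_le.mp (abs_frobeniusTrace_two_le_two W (hasGoodReductionAtPrime_two_of_not_two_dvd W hf hN))
  have h7' : (7 : ℤ) ≤ p := by exact_mod_cast h7
  exact not_natCast_dvd_of_abs_lt (by omega) (by omega) (by omega) hd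

end Odd

/-! ### §3. Every level -/

section All

variable (W : WeierstrassCurve ℚ) [W.IsElliptic] [W.IsGloballyMinimal] {N : ℕ} [NeZero N]

/-- **THEOREM (E-es-210).  For the newform `f` of a globally minimal elliptic `W/ℚ` and every prime `p ≥ 7`:
`p ∤ [Λ₀(f) : Λ₁(f)]`** — the Shimura-cover kernel `Λ₀(f)/Λ₁(f)` (dual to `E₀ ∩ Σ(N)`) is supported on `{2, 3, 5}`.
UNCONDITIONAL: no torsion theorem is used (tree E-an-129 had `p ≥ 11` granted `mazur_torsion`).
[cite: LingOesterle1991, Thm. 6] [cite: SilvermanAEC2009, Thm. V.1.1] [cite: AtkinLehner1970, Thm. 3] -/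
theorem shimuraIndexPrimeTo_of_seven_le {f : CuspForm (Gamma0 N) 2} (hf : IsNewformOf W f) {p : ℕ} (hp : p.Prime)
    (h7 : 7 ≤ p) : ShimuraIndexPrimeTo p f := by
  by_cases hN : 2 ∣ N
  · exact shimuraIndexPrimeTo_of_five_le_of_two_dvd hf.1 hN hp (le_trans (by norm_num) h7)
  · exact shimuraIndexPrimeTo_of_seven_le_of_not_two_dvd W hf hN hp h7

/-- The datum form: for every `X₀(N)`-datum `D` of `W` and every prime `p ≥ 7`, `ShimuraIndexPrimeTo p D.f` (the leaf
`shimuraIndexPrimeTo_of_eleven_le'` with `11` lowered to `7` and `mazur_torsion` removed).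
[cite: LingOesterle1991, Thm. 6] [cite: SilvermanAEC2009, Thm. V.1.1] -/
theorem shimuraIndexPrimeTo_of_seven_le_datum (D : ModularParametrizationData W N) {p : ℕ} (hp : p.Prime) (h7 : 7 ≤ p) :
    ShimuraIndexPrimeTo p D.f :=
  shimuraIndexPrimeTo_of_seven_le W D.isNewformOf hp h7

/-- The plus-index form (leaf `plusIndexPrimeTo_of_eleven_le'` sharpened the same way). [cite: LingOesterle1991, §1 and Thm. 6] -/
theorem plusIndexPrimeTo_of_seven_le_datum (D : ModularParametrizationData W N) {p : ℕ} (hp : p.Prime) (h7 : 7 ≤ p) :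
    PlusIndexPrimeTo p D.f :=
  plusIndexPrimeTo_of_shimuraIndexPrimeTo hp D.f (shimuraIndexPrimeTo_of_seven_le_datum W D hp h7)

/-- **`5 ∣ [Λ₀ : Λ₁]` ⟹ `2 ∤ N` and `a₂(W) = −2`** (every level). Unconditional.
[cite: LingOesterle1991, Thm. 6] [cite: SilvermanAEC2009, Thm. V.1.1] [cite: AtkinLehner1970, Thm. 3] -/
theorem not_two_dvd_and_frobeniusTrace_two_eq_of_not_shimuraIndexPrimeTo_five {f : CuspForm (Gamma0 N) 2}
    (hf : IsNewformOf W f) (hS : ¬ ShimuraIndexPrimeTo 5 f) : ¬ 2 ∣ N ∧ W.frobeniusTrace 2 = -2 := by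
  by_cases hN : 2 ∣ N
  · exact absurd (shimuraIndexPrimeTo_of_five_le_of_two_dvd hf.1 hN Nat.prime_five le_rfl) hS
  · exact ⟨hN, frobeniusTrace_two_eq_of_not_shimuraIndexPrimeTo_five W hf hN hS⟩

/-- **`3 ∣ [Λ₀ : Λ₁]` ⟹ (`2 ∤ N` and `a₂(W) = 0`) or (`2 ∥ N` and `a₂(f) = −1`)** (every level). Unconditional.
[cite: LingOesterle1991, Thm. 6] [cite: SilvermanAEC2009, Thm. V.1.1] [cite: AtkinLehner1970, Thm. 3] -/
theorem shimura_three_cases {f : CuspForm (Gamma0 N) 2} (hf : IsNewformOf W f) (hS : ¬ ShimuraIndexPrimeTo 3 f) :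
    (¬ 2 ∣ N ∧ W.frobeniusTrace 2 = 0) ∨ (2 ∣ N ∧ ¬ 2 ^ 2 ∣ N ∧ cuspCoeff f 2 = -1) := by
  by_cases hN : 2 ∣ N
  · exact Or.inr ⟨hN, cuspCoeff_two_eq_neg_one_of_not_shimuraIndexPrimeTo_three hf.1 hN hS⟩
  · exact Or.inl ⟨hN, frobeniusTrace_two_eq_of_not_shimuraIndexPrimeTo_three W hf hN hS⟩

/-- **`2 ∣ [Λ₀ : Λ₁]` ⟹ (`2 ∤ N` and `a₂(W)` odd) or `4 ∣ N`** (every level; `2 ∥ N` is excluded). Unconditional.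
[cite: LingOesterle1991, Thm. 6] [cite: SilvermanAEC2009, Thm. V.1.1] [cite: AtkinLehner1970, Thm. 3] -/
theorem shimura_two_cases {f : CuspForm (Gamma0 N) 2} (hf : IsNewformOf W f) (hS : ¬ ShimuraIndexPrimeTo 2 f) :
    (¬ 2 ∣ N ∧ (W.frobeniusTrace 2 = 1 ∨ W.frobeniusTrace 2 = -1)) ∨ 2 ^ 2 ∣ N := by
  by_cases hN : 2 ∣ N
  · by_cases h4 : 2 ^ 2 ∣ N
    · exact Or.inr h4
    · exact absurd (shimuraIndexPrimeTo_two_of_two_dvd_of_not_four_dvd hf.1 hN h4) hS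
  · exact Or.inl ⟨hN, frobeniusTrace_two_eq_of_not_shimuraIndexPrimeTo_two W hf hN hS⟩

/-- **EXPONENT FORM (E-es-209): some integer `1 ≤ k ≤ 5` kills the Shimura quotient, `k·Λ₀(f) ⊆ Λ₁(f)`** — `k = 3 − a₂(W)`
at odd level, `k = 2 − a₂(f) ∈ {1, 2, 3}` at even level.  Unconditional (print: `≤ 16` via Mazur, Derickx–Orlić Rmk. 4.8).
[cite: LingOesterle1991, Thm. 6] [cite: SilvermanAEC2009, Thm. V.1.1] [cite: AtkinLehner1970, Thm. 3] -/
theorem exists_intCast_mul_mem_periodLatticeGamma1_le_five {f : CuspForm (Gamma0 N) 2} (hf : IsNewformOf W f) :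
    ∃ k : ℤ, 1 ≤ k ∧ k ≤ 5 ∧ ∀ z ∈ periodLattice f, (k : ℂ) * z ∈ periodLatticeGamma1 f := by
  by_cases hN : 2 ∣ N
  · obtain ⟨e, he, hcase⟩ := exists_cuspCoeff_two_eq_of_two_dvd hf.1 hN
    refine ⟨2 - e, ?_, ?_, fun z hz ↦ ?_⟩
    · rcases hcase with ⟨-, rfl⟩ | ⟨-, rfl | rfl⟩ <;> norm_num
    · rcases hcase with ⟨-, rfl⟩ | ⟨-, rfl | rfl⟩ <;> norm_num
    · have h := sub_two_mul_mem_periodLatticeGamma1_of_two_dvd hf.1 hN hz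
      rw [he] at h
      have h' := neg_mem h
      convert h' using 1
      push_cast
      ring
  · have ha := abs_le.mp (abs_frobeniusTrace_two_le_two W (hasGoodReductionAtPrime_two_of_not_two_dvd W hf hN))
    refine ⟨3 - W.frobeniusTrace 2, by omega, by omega, fun z hz ↦ ?_⟩
    have h' := neg_mem (frobeniusTrace_two_sub_three_mul_mem W hf hN hz)
    convert h' using 1
    push_cast
    ring

/-- Datum form of the exponent bound. [cite: LingOesterle1991, Thm. 6] [cite: SilvermanAEC2009, Thm. V.1.1] -/
theorem exists_intCast_mul_mem_periodLatticeGamma1_le_five_datum (D : ModularParametrizationData W N) :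
    ∃ k : ℤ, 1 ≤ k ∧ k ≤ 5 ∧ ∀ z ∈ periodLattice D.f, (k : ℂ) * z ∈ periodLatticeGamma1 D.f :=
  exists_intCast_mul_mem_periodLatticeGamma1_le_five W D.isNewformOf

end All

end Summit.BirchSwinnertonDyer.BirchSwinnertonDyer.Theorems.ManinLocalTwoThree.ShimuraIndexAtTwo

end
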